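import Summits.QuantumFields.BalabanUV.T4Continuum.Support.VariationalHarmonicApprox
import Summits.QuantumFields.BalabanUV.T4Continuum.Support.VariationalVectorEndOfLeaves

/-!
# T⁴ programme, spine node NE2 (U1a), lane P2 — HARM-APPROX↓: THE PUSHED-DOWN FINE `K′`-HARMONIC IS ENERGY-CLOSE TO THE COARSE `K`-HARMONIC OF THE SAME
# UNIT DATUM — the DUAL of leaf-01-g8's HARM-APPROX, again a corollary of the scalar sector's one-step brackets (FED⁺ at the fine minimiser + ONE⁺ at the
# coarse one) by Pythagoras, now on the COARSE fibre (item «V-AVG-G», file 4; model level; cell `pub-balaban`)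

NE2 formalisation swarm `b2b-balaban-t4-ne2-formalise-*`, leaf prover 10 GEN 4 (`prover-b2b-balaban-t4-ne2-formalise-leaf-10-g4-0`, V-END holder lineage); journal
INTENT «V-AVG-G: THE LOWER BRACKET WITHOUT A SLICE MOVE» CLAIMS.log 2026-08-20 18:22Z l.19093, file 4.  On top of leaf-01-g8's `VariationalHarmonicApprox`
(p230215: `harmApprox_energy`'s letters), leaf-02-g4's `VariationalColourOneStepPhys.Sfv_interpv_le` (ONE⁺) + `VariationalColourInterpolant.Qcv_interpv`,
`VariationalColourScalarPair.Scv_Q1v_le` (FED⁺) and leaf-01-g8's `VariationalVectorGaugeSliceDist.sum_dirUv_eq_add_of_isMin` (Pythagoras on a one-block scalar fibre)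
BY NAME; nothing defined.

WHY.  File 3 (`VariationalVectorAvgGDecomposition`) bounds Bałaban's projected functional of the pushed-down fine minimiser by three legs; the third leg (HARM↓) asks
that the transported block mean `Q₀ h′` of the fine slice representative `h′ ∈ S′ᗮ` be close in `ℓ²` to SOME coarse `u ∈ Sᗮ`.  By p229806 §2 the slice complements
ARE the scalar sector's fibre-minimiser spaces, so the needed statement is the mirror image of leaf-01-g8's HARM-APPROX: for a unit datum `ψ`, the FINE scalar
minimiser `u` (level `nL`, composite average), its PUSH-DOWN `Q₁ u` (IN the coarse fibre of `ψ` by construction of the composite average) and the COARSE scalar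
minimiser `s` (level `n`, same datum) satisfy `Sc (Q₁ u − s) ≤ e_H↓·‖ψ‖²`.
PROOF (§1 `harmApproxDown_energy`): Pythagoras on the COARSE fibre `Sc (Q₁ u) = Sc s + Sc (Q₁ u − s)`; FED⁺ at `u`: `Sc (Q₁ u) ≤ (√(Sf u) + δ√(qV u))²`; the fine
minimality of `u` against the one-step competitor `j` of `s` (ONE⁺): `Sf u ≤ Sf j ≤ (√(Sc s + ε₁ρ s) + δ′√(qW s))²`; then REG⁺ ∕ P⁺ ∕ UB⁺ at `s` and fine P⁺ ∕ UB⁺ at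
`u` turn everything into multiples of `‖ψ‖²`:
    `Sc (Q₁ u − s) ≤ e_H↓·‖ψ‖²`,  `e_H↓ = ePV Λ C_P C_R ε₁ δ′ + eV Λ C_P δ`  (the two one-step defect constants of `VariationalVectorEndOfLeaves`, p220074, BY NAME)
and the coarse P⁺ on the kernel element gives `qW (Q₁ u − s) ≤ C_P·e_H↓·‖ψ‖²` (`harmApproxDown_mass`).
 * §1 abstract letters (the binders of `harmApprox_energy` with `hPyth` ↦ `hPythC` = Pythagoras on the COARSE fibre, and the kernel-additivity of `Qk`);
 * §2 colour letters: **`harmApproxDown_colour`** — ONE⁺, FED⁺, coarse Pythagoras DISCHARGED (`Sfv_interpv_le` + `Qcv_interpv`, `Scv_Q1v_le`, `sum_dirUv_eq_add_of_isMin`);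
   UB⁺ ∕ P⁺ (both levels) ∕ REG⁺ DISPLAYED in the exact shapes of `harmApprox_colour` (= `colour_pair_closed_local`'s `have`s), so the holder of a data class closes
   both twins with the same four lines; `ε₁ = (d∕4 + 1∕2)·L∕n²`, `δ′ = √(2d(1+d²))·(nLm₁)`, `δ = √d·(nm)` as there.
In file 3's leg, `u := s` (read through `toLp_mem_orthogonal_iff_isMin`) and the `ℓ²` distance `‖toLp(Q₁ h′) − toLp s‖² = nsqv (Q1v h′ − s) = n^d·qWv (Q1v h′ − s)`;
the `n^d` and file 3's `L²·(n^d)⁻¹n²` are paid by the smallness of the divergence datum (`nsqv ψ′ ≤ (nL)^{−d}·nsqv h′ ≤ (nL)^{−d}·divSq′`, Jensen) — that assembly, with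
(GF3) for `divSq′`, is file 5.

HONEST FRAMING (T4-DAG p. 1).  Composition of landed scalar-sector lemmas at MODEL level (transports ∕ site operators DATA, c5); [folklore]; nothing printed is a
hypothesis; no `def`, no `def … : Prop`, no `sorry`; axioms standard.  This is the SCALAR half of (G″)'s third leg only; (G″) ∕ the lower bracket with background
NOT proved here; V-END with background ∕ NE2 NOT proved; NE3 OPEN; spine PROVED 0∕9 unchanged; rung (B)+1 on a fixed finite T⁴ — NOT infinite volume, NOT mass
gap, NOT Clay.  HONEST DEPENDENCY (cell, verbatim): continuum YM on T⁴ ⇐ BetaPertH ∧ nine spine estimates (0/9 proved); BetaPertH ⇐ (D1) ∧ (D4) ∧ CAP+tail;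
G-an2-4 gates asym, D1 and NE2/3/4.
-/

noncomputable section

namespace Summit.QuantumFields.BalabanUV.T4Continuum.VariationalHarmonicApproxDown

open Finset
open Literature.MathematicalPhysics.QuantumFieldTheory.Balaban1983to89.B5Prop11Plancherel (Tor fine unitVec)
open Literature.MathematicalPhysics.QuantumFieldTheory.Balaban1983to89.B5Block118 (bpt)
open Summit.QuantumFields.BalabanUV.T4Continuum.VariationalColourFederbush (cDv dirUv dirUv_nonneg Qcv misv)
open Summit.QuantumFields.BalabanUV.T4Continuum.VariationalColourUpperBound (nsqv nsqv_nonneg)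
open Summit.QuantumFields.BalabanUV.T4Continuum.VariationalColourInterpolant (interpv Qcv_interpv)
open Summit.QuantumFields.BalabanUV.T4Continuum.VariationalColourOneStepPhys (rhov rhov_nonneg Sfv_interpv_le)
open Summit.QuantumFields.BalabanUV.T4Continuum.VariationalColourScalarPair (Scv Sfv qWv qVv Qkv Q1v Scv_nonneg Sfv_nonneg qWv_nonneg qVv_nonneg Scv_Q1v_le)
open Summit.QuantumFields.BalabanUV.T4Continuum.VariationalVectorGaugeSliceDist (sum_dirUv_eq_add_of_isMin)
open Summit.QuantumFields.BalabanUV.T4Continuum.VariationalVectorEndOfLeaves (eV ePV)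

/-! ## §1 Abstract letters -/

section Abstract

variable {V W Z : Type*}

/-- the END's `defect_bound` (p217654 lineage, `VariationalCovariantAssembly`) read additively: if `s ≤ Λ·z` and `v ≤ P·z` (all nonnegative) then
`(√s + δ√v)² ≤ s + (2δ√(ΛP) + δ²P)·z`. [folklore] -/
theorem sq_sqrt_add_le_add_defect {s v z Λ P δ : ℝ} (hs0 : 0 ≤ s) (hv0 : 0 ≤ v) (hδ : 0 ≤ δ) (hΛ : 0 ≤ Λ) (hP : 0 ≤ P) (hz : 0 ≤ z)
    (hs : s ≤ Λ * z) (hv : v ≤ P * z) :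
    (Real.sqrt s + δ * Real.sqrt v) ^ 2 ≤ s + (2 * δ * Real.sqrt (Λ * P) + δ ^ 2 * P) * z := by
  have hdef := VariationalCovariantAssembly.defect_bound (s := s) (v := v) (z := z) (Λ := Λ) (P := P) hδ hΛ hP hz hs hv
  rw [add_sq, Real.sq_sqrt hs0, mul_pow, Real.sq_sqrt hv0]
  linarith

/-- **HARM-APPROX↓, ENERGY FORM (abstract)**: coarse form `Sc`, fine form `Sf` (`≥ 0`), composite average `Qk ∘ Q₁`; a coarse fibre-minimiser `s` of datum `ψ`, a fine
fibre-minimiser `u` of the same datum, and the one-step competitor `j` of `s` in the fine fibre with the ONE⁺ bound; FED⁺ at `u`; Pythagoras on the COARSE fibre;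
UB⁺ ∕ P⁺ ∕ REG⁺ at `s`, fine P⁺ ∕ UB⁺ at `u` ⟹ `Sc (Q₁ u − s) ≤ (ePV Λ C_P C_R ε₁ δ′ + eV Λ C_P δ)·qZ ψ`. [folklore] -/
theorem harmApproxDown_energy [AddCommGroup W] {Sc : W → ℝ} {Sf : V → ℝ} {Qk : W → Z} {Q₁ : V → W} {qW : W → ℝ} {qV : V → ℝ} {qZ : Z → ℝ} {ρ : W → ℝ}
    (hSc0 : ∀ f, 0 ≤ Sc f) (hSf0 : ∀ g, 0 ≤ Sf g) (hqW0 : ∀ f, 0 ≤ qW f) (hqV0 : ∀ g, 0 ≤ qV g) (hqZ0 : ∀ ψ, 0 ≤ qZ ψ) (hρ0 : ∀ f, 0 ≤ ρ f)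
    {Λ CP CR δ ε₁ δ' : ℝ} (hΛ : 0 ≤ Λ) (hCP : 0 ≤ CP) (hCR : 0 ≤ CR) (hδ : 0 ≤ δ) (hε₁ : 0 ≤ ε₁) (hδ' : 0 ≤ δ')
    -- the leaves, as displayed binders
    (hUBc : ∀ ψ, ∃ f, Qk f = ψ ∧ Sc f ≤ Λ * qZ ψ) (hUBf : ∀ ψ, ∃ g, Qk (Q₁ g) = ψ ∧ Sf g ≤ Λ * qZ ψ)
    (hPc : ∀ f, qW f ≤ CP * (Sc f + qZ (Qk f))) (hPf : ∀ g, qV g ≤ CP * (Sf g + qZ (Qk (Q₁ g))))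
    (hFED : ∀ g, Sc (Q₁ g) ≤ (Real.sqrt (Sf g) + δ * Real.sqrt (qV g)) ^ 2)
    (hREG : ∀ ψ f, Qk f = ψ → (∀ f₂, Qk f₂ = ψ → Sc f ≤ Sc f₂) → ρ f ≤ CR * (Sc f + qZ ψ))
    (hPythC : ∀ ψ s f, Qk s = ψ → (∀ f₂, Qk f₂ = ψ → Sc s ≤ Sc f₂) → Qk f = ψ → Sc f = Sc s + Sc (f - s))
    -- the data: datum, coarse minimiser, fine minimiser, competitor with the ONE⁺ bound
    {ψ : Z} {s : W} (hs : Qk s = ψ) (hsmin : ∀ f₂, Qk f₂ = ψ → Sc s ≤ Sc f₂)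
    {u : V} (hu : Qk (Q₁ u) = ψ) (humin : ∀ g₂, Qk (Q₁ g₂) = ψ → Sf u ≤ Sf g₂)
    {j : V} (hj : Qk (Q₁ j) = ψ) (hONE : Sf j ≤ (Real.sqrt (Sc s + ε₁ * ρ s) + δ' * Real.sqrt (qW s)) ^ 2) :
    Sc (Q₁ u - s) ≤ (ePV Λ CP CR ε₁ δ' + eV Λ CP δ) * qZ ψ := by
  set A := Sc s with hA
  set F := Sf u with hF
  set z := qZ ψ with hz
  have hA0 : 0 ≤ A := hSc0 s
  have hF0 : 0 ≤ F := hSf0 u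
  have hz0 : 0 ≤ z := hqZ0 ψ
  -- UB⁺ at both levels through minimality
  have hAΛ : A ≤ Λ * z := by obtain ⟨f, hf, hb⟩ := hUBc ψ; exact (hsmin f hf).trans hb
  have hFΛ : F ≤ Λ * z := by obtain ⟨g, hg, hb⟩ := hUBf ψ; exact (humin g hg).trans hb
  -- P⁺, REG⁺ at the coarse minimiser; fine P⁺ at the fine minimiser
  have hqW : qW s ≤ CP * (A + z) := by have := hPc s; rw [hs] at this; exact this
  have hρ : ρ s ≤ CR * (A + z) := hREG ψ s hs hsmin
  have hqV : qV u ≤ CP * (F + z) := by have := hPf u; rw [hu] at this; exact this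
  have h2 : qW s ≤ CP * (Λ + 1) * z := by
    calc qW s ≤ CP * (A + z) := hqW
      _ ≤ CP * (Λ * z + z) := by gcongr
      _ = CP * (Λ + 1) * z := by ring
  have h3 : qV u ≤ CP * (Λ + 1) * z := by
    calc qV u ≤ CP * (F + z) := hqV
      _ ≤ CP * (Λ * z + z) := by gcongr
      _ = CP * (Λ + 1) * z := by ring
  have hρ' : ε₁ * ρ s ≤ ε₁ * CR * (Λ + 1) * z := by
    calc ε₁ * ρ s ≤ ε₁ * (CR * (A + z)) := mul_le_mul_of_nonneg_left hρ hε₁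
      _ ≤ ε₁ * (CR * (Λ * z + z)) := by gcongr
      _ = ε₁ * CR * (Λ + 1) * z := by ring
  have h4 : A + ε₁ * ρ s ≤ (Λ + ε₁ * CR * (Λ + 1)) * z := by linarith
  -- Pythagoras on the coarse fibre: `Sc (Q₁ u − s) = Sc (Q₁ u) − A`
  have hP : Sc (Q₁ u - s) = Sc (Q₁ u) - A := by have := hPythC ψ s (Q₁ u) hs hsmin hu; linarith
  -- FED⁺ at `u`, read additively: `Sc (Q₁ u) ≤ F + eV Λ CP δ · z`
  have hFEDu : Sc (Q₁ u) ≤ F + eV Λ CP δ * z := by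
    have h := sq_sqrt_add_le_add_defect hF0 (hqV0 u) hδ hΛ (by positivity : (0 : ℝ) ≤ CP * (Λ + 1)) hz0 hFΛ h3
    unfold eV
    exact (hFED u).trans h
  -- fine minimality against the competitor + ONE⁺, read additively: `F ≤ A + ePV Λ CP CR ε₁ δ′ · z`
  have hONEu : F ≤ A + ePV Λ CP CR ε₁ δ' * z := by
    have hmin : F ≤ Sf j := humin j hj
    have h := sq_sqrt_add_le_add_defect (s := A + ε₁ * ρ s) (v := qW s) (z := z) (Λ := Λ + ε₁ * CR * (Λ + 1)) (P := CP * (Λ + 1)) (δ := δ')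
      (by have := hρ0 s; positivity) (hqW0 s) hδ' (by positivity) (by positivity) hz0 h4 h2
    unfold ePV
    linarith [hmin.trans (hONE.trans h)]
  rw [hP]
  linarith [add_mul (ePV Λ CP CR ε₁ δ') (eV Λ CP δ) z]

/-- **HARM-APPROX↓, `ℓ²` FORM (abstract)**: with the coarse P⁺ on the KERNEL element `Q₁ u − s` (`Qk (Q₁ u − s) = 0` by the additivity `hQsub` and `qZ 0 = 0`),
`qW (Q₁ u − s) ≤ C_P·(ePV Λ C_P C_R ε₁ δ′ + eV Λ C_P δ)·qZ ψ`. [folklore] -/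
theorem harmApproxDown_mass [AddCommGroup W] [AddGroup Z] {Sc : W → ℝ} {Sf : V → ℝ} {Qk : W → Z} {Q₁ : V → W} {qW : W → ℝ} {qV : V → ℝ} {qZ : Z → ℝ}
    {ρ : W → ℝ}
    (hSc0 : ∀ f, 0 ≤ Sc f) (hSf0 : ∀ g, 0 ≤ Sf g) (hqW0 : ∀ f, 0 ≤ qW f) (hqV0 : ∀ g, 0 ≤ qV g) (hqZ0 : ∀ ψ, 0 ≤ qZ ψ) (hqZ00 : qZ 0 = 0)
    (hρ0 : ∀ f, 0 ≤ ρ f)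
    {Λ CP CR δ ε₁ δ' : ℝ} (hΛ : 0 ≤ Λ) (hCP : 0 ≤ CP) (hCR : 0 ≤ CR) (hδ : 0 ≤ δ) (hε₁ : 0 ≤ ε₁) (hδ' : 0 ≤ δ')
    (hUBc : ∀ ψ, ∃ f, Qk f = ψ ∧ Sc f ≤ Λ * qZ ψ) (hUBf : ∀ ψ, ∃ g, Qk (Q₁ g) = ψ ∧ Sf g ≤ Λ * qZ ψ)
    (hPc : ∀ f, qW f ≤ CP * (Sc f + qZ (Qk f))) (hPf : ∀ g, qV g ≤ CP * (Sf g + qZ (Qk (Q₁ g))))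
    (hFED : ∀ g, Sc (Q₁ g) ≤ (Real.sqrt (Sf g) + δ * Real.sqrt (qV g)) ^ 2)
    (hREG : ∀ ψ f, Qk f = ψ → (∀ f₂, Qk f₂ = ψ → Sc f ≤ Sc f₂) → ρ f ≤ CR * (Sc f + qZ ψ))
    (hPythC : ∀ ψ s f, Qk s = ψ → (∀ f₂, Qk f₂ = ψ → Sc s ≤ Sc f₂) → Qk f = ψ → Sc f = Sc s + Sc (f - s))
    (hQsub : ∀ f f', Qk (f - f') = Qk f - Qk f')
    {ψ : Z} {s : W} (hs : Qk s = ψ) (hsmin : ∀ f₂, Qk f₂ = ψ → Sc s ≤ Sc f₂)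
    {u : V} (hu : Qk (Q₁ u) = ψ) (humin : ∀ g₂, Qk (Q₁ g₂) = ψ → Sf u ≤ Sf g₂)
    {j : V} (hj : Qk (Q₁ j) = ψ) (hONE : Sf j ≤ (Real.sqrt (Sc s + ε₁ * ρ s) + δ' * Real.sqrt (qW s)) ^ 2) :
    qW (Q₁ u - s) ≤ CP * ((ePV Λ CP CR ε₁ δ' + eV Λ CP δ) * qZ ψ) := by
  have hE := harmApproxDown_energy hSc0 hSf0 hqW0 hqV0 hqZ0 hρ0 hΛ hCP hCR hδ hε₁ hδ' hUBc hUBf hPc hPf hFED hREG hPythC hs hsmin hu humin hj hONE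
  have hker : Qk (Q₁ u - s) = 0 := by rw [hQsub, hu, hs, sub_self]
  have h := hPc (Q₁ u - s)
  rw [hker, hqZ00, add_zero] at h
  exact h.trans (mul_le_mul_of_nonneg_left hE hCP)

end Abstract

/-! ## §2 Colour letters: ONE⁺, FED⁺ and the coarse Pythagoras DISCHARGED; UB⁺ ∕ P⁺ ∕ REG⁺ displayed in `harmApprox_colour`'s shapes -/

section Colour

variable {d : ℕ} {E : Type*} [NormedAddCommGroup E] [InnerProductSpace ℂ E] [CompleteSpace E] [FiniteDimensional ℂ E]
variable (n L : ℕ) [NeZero n] [NeZero L] (M : Fin d → ℕ) [hM : ∀ μ, NeZero (M μ)]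

omit [CompleteSpace E] [FiniteDimensional ℂ E] [NeZero L] in
/-- **PYTHAGORAS FOR THE COARSE COLOUR FIBRE in physical units**: `Scv f = Scv s + Scv (f − s)` for a minimiser `s` of `Scv` on `{Qkv T · = ψ}` and `f` in the same
fibre (leaf-01-g8's `sum_dirUv_eq_add_of_isMin` on the one-block average, rescaled). [folklore] -/
theorem Scv_eq_add_of_isMin (T : Tor (fine n M) → (E →L[ℂ] E)) (Rc : Tor (fine n M) → Fin d → (E →L[ℂ] E)) {ψ : Tor M → E} {s : Tor (fine n M) → E}
    (hs : Qkv n M T s = ψ) (hsmin : ∀ f₂, Qkv n M T f₂ = ψ → Scv n M Rc s ≤ Scv n M Rc f₂) {f : Tor (fine n M) → E} (hf : Qkv n M T f = ψ) :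
    Scv n M Rc f = Scv n M Rc s + Scv n M Rc (f - s) := by
  have hc : 0 < (n : ℝ) ^ 2 / (n : ℝ) ^ d := by
    have : (0 : ℝ) < n := by exact_mod_cast Nat.pos_of_ne_zero (NeZero.ne n)
    positivity
  have hs' : Qcv n M T s = ψ := hs
  have hsmin' : ∀ g, Qcv n M T g = ψ → ∑ ν, dirUv (fine n M) Rc s ν ≤ ∑ ν, dirUv (fine n M) Rc g ν := by
    intro g hg
    have h := hsmin g hg
    unfold Scv at h
    exact le_of_mul_le_mul_left h hc
  have e := sum_dirUv_eq_add_of_isMin n M T Rc hs' hsmin' (g := f) hf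
  unfold Scv
  rw [e, mul_add]

omit [FiniteDimensional ℂ E] in
/-- **HARM-APPROX↓ IN THE COLOUR LETTERS** (model level; `E` a finite-dimensional Hilbert space; ONE⁺, FED⁺, coarse Pythagoras DISCHARGED; UB⁺ ∕ P⁺ ∕ REG⁺ DISPLAYED in
the shapes of `harmApprox_colour`): for a unit datum `ψ`, a coarse fibre-minimiser `s` of `Scv` under `Qkv T`, a fine fibre-minimiser `u` of `Sfv` under the composite
`Qkv T ∘ Q1v T′`: the PUSH-DOWN `Q1v T′ u` lies in the coarse fibre of `ψ` and
`Scv (Q1v u − s) ≤ e_H↓·nsqv ψ`, `qWv (Q1v u − s) ≤ C_P·e_H↓·nsqv ψ`, `e_H↓ = ePV Λ C_P C_R ε₁ δ′ + eV Λ C_P δ` with `ε₁ = (d∕4 + 1∕2)·L∕n²`,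
`δ′ = √(2d(1+d²))·(nLm₁)`, `δ = √d·(nm)`. [folklore] -/
theorem harmApproxDown_colour {Rc : Tor (fine n M) → Fin d → (E →L[ℂ] E)} {R' : Tor (fine L (fine n M)) → Fin d → (E →L[ℂ] E)}
    {T : Tor (fine n M) → (E →L[ℂ] E)} {T' : Tor (fine L (fine n M)) → (E →L[ℂ] E)}
    (hT' : ∀ x, T' x ∈ unitary (E →L[ℂ] E)) (hRc : ∀ y μ, Rc y μ ∈ unitary (E →L[ℂ] E)) (hR' : ∀ x μ, ‖R' x μ‖ ≤ 1)
    -- FED⁺ data: one-block transport mismatch `m`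
    {m : ℝ} (hm : 0 ≤ m) (hmis : ∀ y μ j, ‖misv L (fine n M) Rc R' T' y μ j‖ ≤ m)
    -- ONE⁺ data: in-block ∕ crossing frame defects `m₁`
    {m₁ : ℝ} (hm₁ : 0 ≤ m₁)
    (hin : ∀ (y : Tor (fine n M)) (j : Fin d → Fin L) (μ : Fin d), (j μ : ℕ) + 1 < L →
      ‖R' (bpt L (fine n M) y j) μ * star (T' (bpt L (fine n M) y j + unitVec (fine L (fine n M)) μ)) - star (T' (bpt L (fine n M) y j))‖ ≤ m₁)
    (hcross : ∀ (y : Tor (fine n M)) (j : Fin d → Fin L) (μ : Fin d), (j μ : ℕ) + 1 = L →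
      ‖R' (bpt L (fine n M) y j) μ * star (T' (bpt L (fine n M) y j + unitVec (fine L (fine n M)) μ))
        - star (T' (bpt L (fine n M) y j)) * Rc y μ‖ ≤ m₁)
    -- the displayed leaves UB⁺ (both levels), P⁺ (both levels), REG⁺
    {Λ CP CR : ℝ} (hΛ : 0 ≤ Λ) (hCP : 0 ≤ CP) (hCR : 0 ≤ CR)
    (hUBc : ∀ ψ : Tor M → E, ∃ f, Qkv n M T f = ψ ∧ Scv n M Rc f ≤ Λ * nsqv ψ)
    (hUBf : ∀ ψ : Tor M → E, ∃ g, Qkv n M T (Q1v n L M T' g) = ψ ∧ Sfv n L M R' g ≤ Λ * nsqv ψ)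
    (hPc : ∀ f, qWv n M f ≤ CP * (Scv n M Rc f + nsqv (Qkv n M T f)))
    (hPf : ∀ g, qVv n L M g ≤ CP * (Sfv n L M R' g + nsqv (Qkv n M T (Q1v n L M T' g))))
    (hREG : ∀ (ψ : Tor M → E) f, Qkv n M T f = ψ → (∀ f₂, Qkv n M T f₂ = ψ → Scv n M Rc f ≤ Scv n M Rc f₂) →
      rhov n M Rc f ≤ CR * (Scv n M Rc f + nsqv ψ))
    -- the data: datum, coarse and fine minimisers
    {ψ : Tor M → E} {s : Tor (fine n M) → E} (hs : Qkv n M T s = ψ) (hsmin : ∀ f₂, Qkv n M T f₂ = ψ → Scv n M Rc s ≤ Scv n M Rc f₂)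
    {u : Tor (fine L (fine n M)) → E} (hu : Qkv n M T (Q1v n L M T' u) = ψ)
    (humin : ∀ g₂, Qkv n M T (Q1v n L M T' g₂) = ψ → Sfv n L M R' u ≤ Sfv n L M R' g₂) :
    let ε₁ : ℝ := ((d : ℝ) / 4 + 1 / 2) * ((L : ℝ) / (n : ℝ) ^ 2)
    let δ' : ℝ := Real.sqrt (2 * d * (1 + (d : ℝ) ^ 2)) * ((n : ℝ) * L * m₁)
    let δ : ℝ := Real.sqrt d * ((n : ℝ) * m)
    let eH : ℝ := ePV Λ CP CR ε₁ δ' + eV Λ CP δ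
    Scv n M Rc (Q1v n L M T' u - s) ≤ eH * nsqv ψ ∧ qWv n M (Q1v n L M T' u - s) ≤ CP * (eH * nsqv ψ) := by
  intro ε₁ δ' δ eH
  have hε₁ : 0 ≤ ε₁ := by positivity
  have hδ' : 0 ≤ δ' := by positivity
  have hδ : 0 ≤ δ := by positivity
  have hT1 : ∀ x, ‖T' x‖ ≤ 1 := fun x => VariationalColourFederbush.norm_le_one_of_mem_unitary (hT' x)
  -- the competitor: in the composite fibre (`Qcv_interpv`) with the ONE⁺ bound (`Sfv_interpv_le`)
  have hQ1j : Q1v n L M T' (interpv L (fine n M) T' Rc s) = s := Qcv_interpv L (fine n M) Rc s hT'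
  have hj : Qkv n M T (Q1v n L M T' (interpv L (fine n M) T' Rc s)) = ψ := by rw [hQ1j, hs]
  have hONE : Sfv n L M R' (interpv L (fine n M) T' Rc s) ≤ (Real.sqrt (Scv n M Rc s + ε₁ * rhov n M Rc s) + δ' * Real.sqrt (qWv n M s)) ^ 2 := by
    have h := Sfv_interpv_le n L M hT' hRc hm₁ hin hcross s
    have e1 : ((d : ℝ) / 4 + 1 / 2) * ((L : ℝ) / (n : ℝ) ^ 2) * rhov n M Rc s = ε₁ * rhov n M Rc s := rfl
    rw [e1] at h
    exact h
  -- FED⁺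
  have hFED : ∀ g, Scv n M Rc (Q1v n L M T' g) ≤ (Real.sqrt (Sfv n L M R' g) + δ * Real.sqrt (qVv n L M g)) ^ 2 := fun g =>
    Scv_Q1v_le n L M hR' hT1 hm hmis g
  -- Pythagoras on the coarse fibre
  have hPythC : ∀ (ψ' : Tor M → E) (s' f : Tor (fine n M) → E), Qkv n M T s' = ψ' → (∀ f₂, Qkv n M T f₂ = ψ' → Scv n M Rc s' ≤ Scv n M Rc f₂) →
      Qkv n M T f = ψ' → Scv n M Rc f = Scv n M Rc s' + Scv n M Rc (f - s') := fun ψ' s' f hs' hmin' hf => Scv_eq_add_of_isMin n M T Rc hs' hmin' hf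
  have hE := harmApproxDown_energy (V := Tor (fine L (fine n M)) → E) (W := Tor (fine n M) → E) (Z := Tor M → E)
    (Sc := Scv n M Rc) (Sf := Sfv n L M R') (Qk := Qkv n M T) (Q₁ := Q1v n L M T') (qW := qWv n M) (qV := qVv n L M) (qZ := nsqv) (ρ := rhov n M Rc)
    (Scv_nonneg n M Rc) (Sfv_nonneg n L M R') (qWv_nonneg n M) (qVv_nonneg n L M) nsqv_nonneg (rhov_nonneg n M Rc)
    hΛ hCP hCR hδ hε₁ hδ' hUBc hUBf hPc hPf hFED hREG hPythC hs hsmin hu humin hj hONE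
  -- the coarse average is additive (leaf-02-g6's `VariationalColourLipschitzRepair.Qkv_sub`, inlined to keep the import list short)
  have hQsub : ∀ f f' : Tor (fine n M) → E, Qkv n M T (f - f') = Qkv n M T f - Qkv n M T f' := fun f f' => by
    funext z; simp only [Qkv, Qcv, Pi.sub_apply, map_sub, Finset.sum_sub_distrib, smul_sub]
  have hker : Qkv n M T (Q1v n L M T' u - s) = 0 := by rw [hQsub, hu, hs, sub_self]
  refine ⟨hE, ?_⟩
  have h := hPc (Q1v n L M T' u - s)
  rw [hker] at h
  have h0 : nsqv (0 : Tor M → E) = 0 := by unfold nsqv; simp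
  rw [h0, add_zero] at h
  exact h.trans (mul_le_mul_of_nonneg_left hE hCP)

end Colour

end Summit.QuantumFields.BalabanUV.T4Continuum.VariationalHarmonicApproxDown

end
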